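import Literature.AlgebraicTopology.SingularHomology.PositiveAtlasOrientation
import Literature.AlgebraicTopology.SingularHomology.FundamentalClassExistence
import HarnessLib

/-!
# Positive-atlas orientations are natural under orientation-preserving local homeomorphisms;
# degree one from one good fibre

A. Hatcher, *Algebraic Topology* (2002), §3.3 p. 231 (local homology is local), p. 233 with
§2.2 Exercise 7 (a `C¹` local homeomorphism acts on `Hₙ(ℝⁿ | ·)` by the sign of its Jacobian),
Thm. 3.26 and Exercise 8 (degree of a map of closed oriented manifolds); G. E. Bredon, *Topology
and Geometry* (1993), VI.7 (proof of Thm. 7.15). For spaces `X'`, `X` charted over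
`𝔼 = EuclideanSpace ℝ (Fin n)` with the `ℤ`-orientations of POSITIVE atlases
(`positiveAtlasOrientation`, file `PositiveAtlasOrientation`) and a continuous `f : X' → X` which is a
local homeomorphism near `x` (packaged as an `OpenPartialHomeomorph` whose total function is `f`):

* `localHomology.map_chartXEquiv_trans_symm` — **naturality of the chart identification**: for a
  chart `c` of `X` at `f x`, `f_* ∘ (chartXEquiv (e.trans c))⁻¹ = (chartXEquiv c)⁻¹` on
  `Hₙ(𝔼 | c (f x))` (`e.trans c` is a chart of `X'` at `x`; excision is transitive and the
  cross-universe transport is natural, `relativeSingularHomology.xEquiv_map` — the argument of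
  `chartXEquiv_restrOpen`);
* `positiveAtlasOrientation_map_localClass` — **`f_* μ'ₓ = μ_{f x}`** when `f` read in the atlas
  charts at `x` and `f x` is differentiable at the point with Jacobian of POSITIVE determinant
  (`chartXEquiv_symm_localClass_eq_of_hasFDerivAt` applied to the two charts `chartAt x` and
  `e.trans (chartAt (f x))` of `X'` at `x`, then the naturality above);
* `hasDegree_one_of_map_localClass_eq` — **degree one from one good fibre**: a map of closed
  manifolds, `X` connected, which is a map of pairs `(X', X' ∖ a) → (X, X ∖ b)` sending `μ'ₐ` to
  `μ_b` has `f_* [X'] = [X]` (naturality of `Hₙ(–) → Hₙ(– | ·)`, Thm. 3.26 (a), and injectivity of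
  `Hₙ(X) → Hₙ(X | b)` for `X` closed connected, Thm. 3.26 (b) — the argument of
  `HodgeTheory/BirationalMorphismDegree`, with the unit now equal to `1`).

Everything is proved; no definitions, no named facts. Consumer: the degree of a birational morphism of
smooth projective complex varieties for the COMPLEX orientations
(`HodgeTheory/ComplexOrientationDegreeOne`).

## References

* [HatcherAT2002] A. Hatcher, Algebraic Topology, CUP 2002, §2.2 Exercise 7, §3.3 pp. 231–236,
  Thm. 3.26, Exercise 8.
* [Bredon1993] G. E. Bredon, Topology and Geometry, GTM 139, Springer 1993, VI.7.
-/

noncomputable section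

open CategoryTheory Limits Set Filter Topology

universe u v

namespace Literature.AlgebraicTopology.SingularHomology

variable {n : ℕ}

/-! ### Naturality of the chart identification of local homology -/

section Naturality

variable {X' X : Type u} [TopologicalSpace X'] [T1Space X'] [TopologicalSpace X] [T1Space X]

/-- **Naturality of `chartXEquiv` under a local homeomorphism.** Let `e : X' ⇀ X` be an open
partial homeomorphism whose total function is continuous, `c` a chart of `X`, `x ∈ (e.trans c).source`
(so `e x ∈ c.source`), and suppose `e` is a map of pairs `(X', X' ∖ x) → (X, X ∖ e x)`. Then for
every `v ∈ Hₖ(𝔼 | c (e x))`, `e_* ((chartXEquiv (e.trans c))⁻¹ v) = (chartXEquiv c)⁻¹ v`: both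
identifications are "excise to the chart domain, transport along the chart", excision is
transitive and the transport is natural for the square `(e.trans c).source → c.source`,
`(e.trans c).target ↪ c.target`. [cite: HatcherAT2002, §3.3 p. 231] -/
theorem localHomology.map_chartXEquiv_trans_symm (e : OpenPartialHomeomorph X' X)
    (hec : Continuous e) (c : OpenPartialHomeomorph X (EuclideanSpace ℝ (Fin n))) {x : X'}
    (hx : x ∈ (e.trans c).source) (hfib : MapsTo e ({x}ᶜ : Set X') ({e x}ᶜ : Set X)) (k : ℕ)
    (v : localHomology ℤ ℤ (EuclideanSpace ℝ (Fin n)) (c (e x)) k) :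
    relativeSingularHomology.map ℤ ℤ (⟨e, hec⟩ : C(X', X)) hfib k
        ((localHomology.chartXEquiv ℤ ℤ (e.trans c) hx k).symm v) =
      (localHomology.chartXEquiv ℤ ℤ c (show e x ∈ c.source from hx.2) k).symm v := by
  set c₂ := e.trans c with hc₂
  have hex : e x ∈ c.source := hx.2
  -- the maps of the square
  let φ : C(↥c₂.source, ↥c.source) :=
    ⟨fun y ↦ ⟨e y, y.2.2⟩, (hec.comp continuous_subtype_val).subtype_mk _⟩
  have hT : c₂.target ⊆ c.target := by
    rw [hc₂, OpenPartialHomeomorph.trans_target]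
    exact inter_subset_left
  let ι' : C(↥c₂.target, ↥c.target) := ⟨Set.inclusion hT, continuous_inclusion hT⟩
  have hφ : MapsTo φ ({(⟨x, hx⟩ : ↥c₂.source)}ᶜ : Set ↥c₂.source)
      ({(⟨e x, hex⟩ : ↥c.source)}ᶜ : Set ↥c.source) := by
    intro y hy hy'
    rw [mem_singleton_iff] at hy'
    have h1 : e (y : X') = e x := congrArg Subtype.val hy'
    have h2 : (y : X') = x := by
      by_contra hne
      exact hfib hne h1
    exact hy (Subtype.ext h2)
  have hι' : MapsTo ι' ({c₂.toHomeomorphSourceTarget ⟨x, hx⟩}ᶜ : Set ↥c₂.target)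
      ({c.toHomeomorphSourceTarget ⟨e x, hex⟩}ᶜ : Set ↥c.target) := by
    intro w hw hw'
    apply hw
    rw [mem_singleton_iff] at hw' ⊢
    have e1 : (w : EuclideanSpace ℝ (Fin n)) = c (e x) := congrArg Subtype.val hw'
    exact Subtype.ext e1
  -- (1) `e ∘ incl_{S₂} = incl_S ∘ φ`
  have h1 : relativeSingularHomology.map ℤ ℤ (⟨e, hec⟩ : C(X', X)) hfib k
        ((localHomology.openSubsetIso ℤ ℤ c₂.open_source hx k).hom
          ((localHomology.xEquiv ℤ ℤ c₂.toHomeomorphSourceTarget ⟨x, hx⟩ k).symm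
            ((localHomology.openSubsetIso ℤ ℤ c₂.open_target (c₂.map_source hx) k).inv v))) =
      (localHomology.openSubsetIso ℤ ℤ c.open_source hex k).hom
        (relativeSingularHomology.map ℤ ℤ φ hφ k
          ((localHomology.xEquiv ℤ ℤ c₂.toHomeomorphSourceTarget ⟨x, hx⟩ k).symm
            ((localHomology.openSubsetIso ℤ ℤ c₂.open_target (c₂.map_source hx) k).inv v))) := by
    change (relativeSingularHomology.map ℤ ℤ (subsetIncl c₂.source)
        (localHomology.mapsTo_subsetIncl_compl hx) k ≫
          relativeSingularHomology.map ℤ ℤ (⟨e, hec⟩ : C(X', X)) hfib k) _ =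
      (relativeSingularHomology.map ℤ ℤ φ hφ k ≫
        relativeSingularHomology.map ℤ ℤ (subsetIncl c.source)
          (localHomology.mapsTo_subsetIncl_compl hex) k) _
    rw [← relativeSingularHomology.map_comp, ← relativeSingularHomology.map_comp]
    rfl
  -- (2) naturality of the transport for the square `h ∘ φ = ι' ∘ h₂`
  have h2 : ∀ z, localHomology.xEquiv ℤ ℤ c.toHomeomorphSourceTarget ⟨e x, hex⟩ k
      (relativeSingularHomology.map ℤ ℤ φ hφ k z) =
        relativeSingularHomology.map ℤ ℤ ι' hι' k
          (localHomology.xEquiv ℤ ℤ c₂.toHomeomorphSourceTarget ⟨x, hx⟩ k z) := fun z ↦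
    relativeSingularHomology.xEquiv_map ℤ ℤ c₂.toHomeomorphSourceTarget
      c.toHomeomorphSourceTarget φ ι' (fun _ ↦ rfl)
      (A := {(⟨x, hx⟩ : ↥c₂.source)}ᶜ) (B := {c₂.toHomeomorphSourceTarget ⟨x, hx⟩}ᶜ)
      (mapsTo_compl_singleton c₂.toHomeomorphSourceTarget.toEquiv ⟨x, hx⟩)
      (mapsTo_symm_compl_singleton c₂.toHomeomorphSourceTarget.toEquiv ⟨x, hx⟩)
      (A₂ := {(⟨e x, hex⟩ : ↥c.source)}ᶜ) (B₂ := {c.toHomeomorphSourceTarget ⟨e x, hex⟩}ᶜ)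
      (mapsTo_compl_singleton c.toHomeomorphSourceTarget.toEquiv ⟨e x, hex⟩)
      (mapsTo_symm_compl_singleton c.toHomeomorphSourceTarget.toEquiv ⟨e x, hex⟩) hφ hι' k z
  have h2' : ∀ w, relativeSingularHomology.map ℤ ℤ φ hφ k
      ((localHomology.xEquiv ℤ ℤ c₂.toHomeomorphSourceTarget ⟨x, hx⟩ k).symm w) =
        (localHomology.xEquiv ℤ ℤ c.toHomeomorphSourceTarget ⟨e x, hex⟩ k).symm
          (relativeSingularHomology.map ℤ ℤ ι' hι' k w) := fun w ↦ by
    rw [LinearEquiv.eq_symm_apply, h2, LinearEquiv.apply_symm_apply]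
  -- (3) excision is transitive on the targets: `exc_{T₂} = ι'_* ≫ exc_T`
  have h3 : relativeSingularHomology.map ℤ ℤ ι' hι' k
      ((localHomology.openSubsetIso ℤ ℤ c₂.open_target (c₂.map_source hx) k).inv v) =
        (localHomology.openSubsetIso ℤ ℤ c.open_target (c.map_source hex) k).inv v := by
    have hTT : (localHomology.openSubsetIso ℤ ℤ c₂.open_target (c₂.map_source hx) k).hom =
        relativeSingularHomology.map ℤ ℤ ι' hι' k ≫
          (localHomology.openSubsetIso ℤ ℤ c.open_target (c.map_source hex) k).hom :=
      relativeSingularHomology.map_comp ℤ ℤ ι' (subsetIncl c.target) hι'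
        (localHomology.mapsTo_subsetIncl_compl (c.map_source hex)) k
    have e1 : ∀ w, (localHomology.openSubsetIso ℤ ℤ c.open_target (c.map_source hex) k).hom
        (relativeSingularHomology.map ℤ ℤ ι' hι' k w) =
          (localHomology.openSubsetIso ℤ ℤ c₂.open_target (c₂.map_source hx) k).hom w := fun w ↦ by
      rw [hTT]; rfl
    apply (localHomology.openSubsetIso ℤ ℤ c.open_target (c.map_source hex) k).toLinearEquiv.injective
    rw [Iso.toLinearEquiv_apply, Iso.toLinearEquiv_apply, e1, Iso.inv_hom_id_apply,
      Iso.inv_hom_id_apply]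
  -- unfold both sides and chain
  have eL : (localHomology.chartXEquiv ℤ ℤ c₂ hx k).symm v =
      (localHomology.openSubsetIso ℤ ℤ c₂.open_source hx k).hom
        ((localHomology.xEquiv ℤ ℤ c₂.toHomeomorphSourceTarget ⟨x, hx⟩ k).symm
          ((localHomology.openSubsetIso ℤ ℤ c₂.open_target (c₂.map_source hx) k).inv v)) := rfl
  have eR : (localHomology.chartXEquiv ℤ ℤ c hex k).symm v =
      (localHomology.openSubsetIso ℤ ℤ c.open_source hex k).hom
        ((localHomology.xEquiv ℤ ℤ c.toHomeomorphSourceTarget ⟨e x, hex⟩ k).symm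
          ((localHomology.openSubsetIso ℤ ℤ c.open_target (c.map_source hex) k).inv v)) := rfl
  rw [eL, eR, h1, h2', h3]

end Naturality

/-! ### Positive-atlas orientations are natural under orientation-preserving local homeomorphisms -/

section PositiveAtlas

variable {X' X : Type u} [TopologicalSpace X'] [T2Space X'] [TopologicalSpace X] [T2Space X]
  [ChartedSpace (EuclideanSpace ℝ (Fin n)) X'] [ChartedSpace (EuclideanSpace ℝ (Fin n)) X]

/-- **`f_* μ'ₓ = μ_{f x}` for positive-atlas orientations and an orientation-preserving local
homeomorphism.** Let `X'`, `X` carry positive atlases with their `ℤ`-orientations `μ'`, `μ`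
(`positiveAtlasOrientation`, same generator convention `g`), and let `e : X' ⇀ X` be an open partial
homeomorphism whose total function is continuous, `x ∈ e.source`, with `e` a map of pairs
`(X', X' ∖ x) → (X, X ∖ e x)`. If `e` read in the atlas charts at `x` and `e x` is differentiable at
`chartAt x x` with Jacobian `A` of POSITIVE determinant, then `e_* μ'ₓ = μ_{e x}`: the charts
`chartAt x` and `e.trans (chartAt (e x))` of `X'` at `x` have the same reference class
(`chartXEquiv_symm_localClass_eq_of_hasFDerivAt`, their transition being the written-out `e`), and
`e_*` carries the latter to the reference class of `chartAt (e x)` at `e x`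
(`localHomology.map_chartXEquiv_trans_symm`). (Bredon VI.7, proof of Thm. 7.15: "a diffeomorphism
acts by the sign of its Jacobian".) [cite: Bredon1993, VI.7] [cite: HatcherAT2002, §3.3 p. 233] -/
theorem positiveAtlasOrientation_map_localClass (hX' : IsPositiveAtlas n X') (hX : IsPositiveAtlas n X)
    (g : HomologicalOrientation ℤ (EuclideanSpace ℝ (Fin n)) n) (e : OpenPartialHomeomorph X' X)
    (hec : Continuous e) {x : X'} (hx : x ∈ e.source)
    (hfib : MapsTo e ({x}ᶜ : Set X') ({e x}ᶜ : Set X))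
    {A : EuclideanSpace ℝ (Fin n) →L[ℝ] EuclideanSpace ℝ (Fin n)}
    (hA : HasFDerivAt (fun v ↦ chartAt (EuclideanSpace ℝ (Fin n)) (e x)
      (e ((chartAt (EuclideanSpace ℝ (Fin n)) x).symm v))) A (chartAt (EuclideanSpace ℝ (Fin n)) x x))
    (hdet : 0 < LinearMap.det (A : EuclideanSpace ℝ (Fin n) →ₗ[ℝ] EuclideanSpace ℝ (Fin n))) :
    relativeSingularHomology.map ℤ ℤ (⟨e, hec⟩ : C(X', X)) hfib n
        ((positiveAtlasOrientation hX' g).localClass x) =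
      (positiveAtlasOrientation hX g).localClass (e x) := by
  have hx₂ : x ∈ (e.trans (chartAt (EuclideanSpace ℝ (Fin n)) (e x))).source :=
    ⟨hx, mem_chart_source _ (e x)⟩
  -- the two charts of `X'` at `x` have the same reference class
  have key := chartXEquiv_symm_localClass_eq_of_hasFDerivAt g
    (e.trans (chartAt (EuclideanSpace ℝ (Fin n)) (e x))) (chartAt (EuclideanSpace ℝ (Fin n)) x) hx₂
    (mem_chart_source _ x) hA hdet.ne'
  rw [if_pos hdet] at key
  rw [positiveAtlasOrientation_localClass, positiveAtlasOrientation_localClass, chartRefFamily_apply,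
    chartRefFamily_apply, key]
  exact localHomology.map_chartXEquiv_trans_symm e hec _ hx₂ hfib n _

end PositiveAtlas

/-! ### Degree one from one good fibre -/

section Degree

variable {R : Type v} [CommRing R]
variable {X' X : Type u} [TopologicalSpace X'] [TopologicalSpace X]
  [CompactSpace X'] [T2Space X'] [ChartedSpace (EuclideanSpace ℝ (Fin n)) X']
  [CompactSpace X] [T2Space X] [ChartedSpace (EuclideanSpace ℝ (Fin n)) X] [ConnectedSpace X]

/-- **Degree one from one good fibre.** Let `f : X' → X` be a map of closed topological
`n`-manifolds, `X` connected, `μ'` an `R`-orientation of `X'` and `μ` one of `X`, and let `a ∈ X'`,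
`b ∈ X` with `f (X' ∖ a) ⊆ X ∖ b` and `f_* μ'ₐ = μ_b` in `Hₙ(X | b; R)`. Then `f_* [X']_{μ'} = [X]_μ`
(`HasDegree μ' μ f 1`): both classes restrict to `μ_b` at `b` (naturality of `Hₙ(–) → Hₙ(– | ·)` and
Thm. 3.26 (a), `isFundamentalClass_fundamentalClass_holds`), and `Hₙ(X; R) → Hₙ(X | b; R)` is
injective for `X` closed connected (Thm. 3.26 (b), `toLocal_injective_of_connectedSpace_holds`).
[cite: HatcherAT2002, §3.3 Thm. 3.26 and Exercise 8] -/
theorem hasDegree_one_of_map_localClass_eq (f : C(X', X)) {a : X'} {b : X}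
    (hfib : MapsTo f ({a}ᶜ : Set X') ({b}ᶜ : Set X)) (μ' : HomologicalOrientation R X' n)
    (μ : HomologicalOrientation R X n)
    (h : relativeSingularHomology.map R R f hfib n (μ'.localClass a) = μ.localClass b) :
    HasDegree μ' μ f 1 := by
  rw [HasDegree, one_zsmul]
  apply singularHomology.toLocal_injective_of_connectedSpace_holds R R X n b
  have hnat := relativeSingularHomology.ofAbsolute_comp_map R R f hfib n
  have h1 : singularHomology.toLocal R R b n (singularHomology.map R R f n μ'.fundamentalClass) =
      relativeSingularHomology.map R R f hfib n
        (singularHomology.toLocal R R a n μ'.fundamentalClass) := by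
    change (singularHomology.map R R f n ≫ relativeSingularHomology.ofAbsolute R R X {b}ᶜ n)
        μ'.fundamentalClass =
      (relativeSingularHomology.ofAbsolute R R X' {a}ᶜ n ≫ relativeSingularHomology.map R R f hfib n)
        μ'.fundamentalClass
    rw [hnat]
  rw [h1, HomologicalOrientation.isFundamentalClass_fundamentalClass_holds n μ' a,
    HomologicalOrientation.isFundamentalClass_fundamentalClass_holds n μ b]
  exact h

end Degree

end Literature.AlgebraicTopology.SingularHomology

end
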